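import Literature.NumberTheory.Automorphic.PiOfArtinRepOfTwistedHeckeTheoryGL2Proofs
import Literature.NumberTheory.Automorphic.StandardLTheoryGL2
import HarnessLib

/-!
# `JacquetLanglands1970_standardLTheoryGL2 ⟹ JacquetLanglands1970_twistedHeckeTheoryGL2 ⟹ Gelbart's Prop. 4.1`

Topic `Literature/NumberTheory/Automorphic`. Proofs only (D-0014: no `sorry`, no new definition, no
new named fact). The librarian vendored the purely automorphic standard `L`-function theory of
cuspidal `GL(2)` as the named fact `JacquetLanglands1970_standardLTheoryGL2`
(`StandardLTheoryGL2.lean`), whose body is verbatim the hypothesis binder `HL` of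
`JacquetLanglands1970_twistedHeckeTheoryGL2_of_standardLTheoryGL2`
(`PiOfArtinRepOfTwistedHeckeTheoryGL2Proofs.lean`) and of
`frobSatakeCompatibleAt_of_isPiOfArtinRep_both_of_standardLTheoryGL2`
(`PiOfArtinRepStandardLTheoryGL2Proofs.lean`). This file records, BY NAME, the three consequences,
so that one discharge `JacquetLanglands1970_standardLTheoryGL2_holds` closes at once

* the Galois-indexed twisted Hecke theory `JacquetLanglands1970_twistedHeckeTheoryGL2`
  (`TwistedHeckeTheoryGL2.lean`; Jacquet–Langlands 1970, Thm. 11.1, Cor. 11.2 with §12),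
* Gelbart's Prop. 4.1 at the `σ`-unramified places,
  `frobSatakeCompatibleAt_of_isPiOfArtinRep_of_isUnramifiedAt`
  (`PiOfArtinRepAtSigmaUnramifiedPlaces.lean`), and
* its `π`-unramified shadow `frobSatakeCompatibleAt_of_isPiOfArtinRep` (`StrongArtinGL2.lean`).

The mathematics (Artin reciprocity for the auxiliary characters and their powers, Satake parameters
of twists, Chevalley's congruence theorem, the Jacquet–Langlands §12 comparison of Euler products)
is entirely in the two imported proof files; here the named fact is merely substituted for the
displayed binder (the `fun hcpt => h hcpt` η-expansion unfolds the definition).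

## References

* [JacquetLanglands1970] H. Jacquet, R. P. Langlands, Automorphic Forms on GL(2), LNM 114 (1970):
  Thm. 11.1, Cor. 11.2, Thm. 2.18, Props. 3.5, 3.6, 3.8 (i), Lemma 3.9; Lemma 12.5 and the proof of
  Thm. 12.2, pp. 209–211.
* [Gelbart1997] S. Gelbart, Three lectures on the modularity of ρ̄_{E,3} and the Langlands
  reciprocity conjecture (1997): Prop. 4.1, Thm. 3.2, Example 3.2.3.
-/

noncomputable section

namespace Literature.NumberTheory.Automorphic

/-- **`JacquetLanglands1970_standardLTheoryGL2 ⟹ JacquetLanglands1970_twistedHeckeTheoryGL2`**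
(the Galois-indexed twisted Hecke theory of cuspidal `GL(2)` from the purely automorphic standard
`L`-function theory), by `JacquetLanglands1970_twistedHeckeTheoryGL2_of_standardLTheoryGL2`.
[cite: JacquetLanglands1970, Thm. 11.1, Cor. 11.2, Thm. 2.18, Props. 3.5, 3.6, 3.8 (i), Lemma 3.9]
[cite: CasselsFrohlichANT1967, Ch. VII §5.1 Main Theorem (A)] -/
theorem JacquetLanglands1970_twistedHeckeTheoryGL2_of_JacquetLanglands1970_standardLTheoryGL2
    (h : JacquetLanglands1970_standardLTheoryGL2) :
    JacquetLanglands1970_twistedHeckeTheoryGL2 :=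
  JacquetLanglands1970_twistedHeckeTheoryGL2_of_standardLTheoryGL2 (fun hcpt => h hcpt)

/-- **Gelbart's Prop. 4.1 at the `σ`-unramified places from the named fact
`JacquetLanglands1970_standardLTheoryGL2`**: for `π = π(σ)` in the naive sense (`IsPiOfArtinRep`)
and `v ∤ cond σ`, `π` is unramified at `v` with `t_{π_v} = σ(Fr_v)`; by
`frobSatakeCompatibleAt_of_isPiOfArtinRep_of_isUnramifiedAt_of_standardLTheoryGL2`.  When
`JacquetLanglands1970_standardLTheoryGL2_holds` lands,
`frobSatakeCompatibleAt_of_isPiOfArtinRep_of_isUnramifiedAt_holds` is this theorem applied to it.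
[cite: Gelbart1997, Prop. 4.1 (with Thm. 3.2 and Example 3.2.3)]
[cite: JacquetLanglands1970, Thm. 11.1, Cor. 11.2, Lemma 12.5, proof of Thm. 12.2 pp. 209–211] -/
theorem frobSatakeCompatibleAt_of_isPiOfArtinRep_of_isUnramifiedAt_of_JacquetLanglands1970_standardLTheoryGL2
    (h : JacquetLanglands1970_standardLTheoryGL2) :
    frobSatakeCompatibleAt_of_isPiOfArtinRep_of_isUnramifiedAt :=
  frobSatakeCompatibleAt_of_isPiOfArtinRep_of_isUnramifiedAt_of_standardLTheoryGL2 (fun hcpt => h hcpt)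

/-- **The `π`-unramified shadow of Gelbart's Prop. 4.1 (`frobSatakeCompatibleAt_of_isPiOfArtinRep`,
`StrongArtinGL2.lean`) from `JacquetLanglands1970_standardLTheoryGL2`.**
[cite: Gelbart1997, Prop. 4.1] [cite: JacquetLanglands1970, Thm. 11.1, Cor. 11.2, §12] -/
theorem frobSatakeCompatibleAt_of_isPiOfArtinRep_of_JacquetLanglands1970_standardLTheoryGL2
    (h : JacquetLanglands1970_standardLTheoryGL2) :
    frobSatakeCompatibleAt_of_isPiOfArtinRep :=
  (frobSatakeCompatibleAt_of_isPiOfArtinRep_both_of_standardLTheoryGL2 (fun hcpt => h hcpt)).1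

/-- Both facts of Gelbart's Prop. 4.1 at once from `JacquetLanglands1970_standardLTheoryGL2`.
[cite: Gelbart1997, Prop. 4.1] [cite: JacquetLanglands1970, Thm. 11.1, Cor. 11.2, §12] -/
theorem frobSatakeCompatibleAt_of_isPiOfArtinRep_both_of_JacquetLanglands1970_standardLTheoryGL2
    (h : JacquetLanglands1970_standardLTheoryGL2) :
    frobSatakeCompatibleAt_of_isPiOfArtinRep ∧
      frobSatakeCompatibleAt_of_isPiOfArtinRep_of_isUnramifiedAt :=
  frobSatakeCompatibleAt_of_isPiOfArtinRep_both_of_standardLTheoryGL2 (fun hcpt => h hcpt)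


end Literature.NumberTheory.Automorphic

end
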